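import Summits.KontsevichZagierPeriods.KontsevichZagierPeriods.Theorems.SoloBlindZetaBox
import Summits.KontsevichZagierPeriods.KontsevichZagierPeriods.Theorems.SoloBlindZetaTwoReps
import HarnessLib

/-!
# Euler's dilogarithm identity inside the Kontsevich–Zagier rules, I: the pieces

`Li₂(½) = ∫_{0<t₁<t₀<½} dt₀dt₁/(t₀(1-t₁))` is the `ℚ`-rational representation
`D = [½ > t₀ > t₁ > 0, 1/(t₀(1-t₁))]` (`dilogRep`), a corner of Kontsevich's simplex representation
`Λ₂ = [1 > t₀ > t₁ > 0, 1/(t₀(1-t₁))]` of `ζ(2)`.  Euler's evaluation of `Li₂(½)` is, inside the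
rules, a chain of **four moves**; this file carries out the first two (the sequel
`SoloBlindDilog` the other two and the conclusion `simplexTwo_sub_sub`):

1. dissect `Λ₂` at `t₀ = ½` and `t₁ = ½` (rule (3)): `Λ₂ = D + U + P`, with
   `U = [1 > t₀ > t₁ > ½, …]` and the rectangle `P = [t₀ ∈ (½,1), t₁ ∈ (0,½), …]`;
2. the affine reflection `(t₀,t₁) ↦ (1-t₁, 1-t₀)` (rule (2), `|det| = 1`) maps `D` onto `U` and
   preserves the form `dt₀dt₁/(t₀(1-t₁))`: `[U] = [D]`;
3. the affine chart `(t₀,t₁) ↦ (2t₀, 2-2t₁)` (rule (2), `|det| = 4`) maps `P` onto the square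
   `(1,2)²` with integrand `1/(u₀u₁)`: `[P] = [(1,2)², du₀du₁/(u₀u₁)]`;
4. which is, up to a null set, the Fubini product `ℓ × ℓ` of the logarithmic cell
   `ℓ = [[1,2], dx/x]` of `log 2`.

Main results here: `simplexTwo_dissect` (move 1) and `dilogRep_equiv_upper` (move 2).
-/

noncomputable section

namespace Summit.KontsevichZagierPeriods.KontsevichZagierPeriods.Theorems

open Set MeasureTheory
open Literature.ModelTheory.ExponentialFields (IsSemialgebraic isSemialgebraic_setOf_eval_pos)
open MvPolynomial (aeval X)
open Literature.NumberTheory.Transcendental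
open Literature.NumberTheory.Transcendental.KZ

namespace SoloBlind

/-- The coordinate projections of `ℝ²`, as continuous linear maps. -/
abbrev pr2 (i : Fin 2) : (Fin 2 → ℝ) →L[ℝ] ℝ :=
  ContinuousLinearMap.proj (R := ℝ) (φ := fun _ : Fin 2 => ℝ) i

/-! ## Kontsevich's `Λ₂` in coordinates -/

/-- `Λ₂`, Kontsevich's simplex representation of `ζ(2)`. -/
abbrev simplexTwo : IntegralRep 2 := simplexZetaRep 2 le_rfl

/-- The integrand of `Λ₂` is `ω₀(t₀)ω₁(t₁) = (1/t₀)(1/(1-t₁))`. -/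
theorem simplexTwo_integrand (t : Fin 2 → ℝ) :
    simplexTwo.integrand t = 1 / t 0 * (1 / (1 - t 1)) := by
  show mzvIntegrand [1 + 1] t = _
  rw [mzvIntegrand_singleton 1 t, Fin.prod_univ_one]
  rfl

/-- The domain of `Λ₂` is `{0 < t₁ < t₀ < 1}`. -/
theorem mem_simplexTwo_domain {t : Fin 2 → ℝ} :
    t ∈ simplexTwo.domain ↔ 0 < t 1 ∧ t 1 < t 0 ∧ t 0 < 1 := by
  show t ∈ openOrderedSimplex 2 ↔ _
  simp only [openOrderedSimplex, mem_setOf_eq, Fin.forall_fin_two]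
  constructor
  · rintro ⟨⟨-, h1⟩, ⟨h0', -⟩, hA⟩
    exact ⟨h1, hA (show (0 : Fin 2) < 1 by decide), h0'⟩
  · rintro ⟨h1, h10, h0⟩
    refine ⟨⟨by linarith, h1⟩, ⟨h0, by linarith⟩, fun i j hij => ?_⟩
    fin_cases i <;> fin_cases j
    · exact absurd hij (lt_irrefl _)
    · exact h10
    · exact absurd hij (by decide)
    · exact absurd hij (lt_irrefl _)

/-! ## The pieces -/

/-- The form `1/(t₀(1-t₁))`. -/
def dilogFun (t : Fin 2 → ℝ) : ℝ := 1 / (t 0 * (1 - t 1))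

/-- `D = {0 < t₁ < t₀ < ½}`. -/
def dilogDom : Set (Fin 2 → ℝ) := {t | 0 < t 1 ∧ t 1 < t 0 ∧ 2 * t 0 < 1}

/-- `U = {½ < t₁ < t₀ < 1}`. -/
def upperDom : Set (Fin 2 → ℝ) := {t | 1 < 2 * t 1 ∧ t 1 < t 0 ∧ t 0 < 1}

/-- `P = (½,1) × (0,½)`. -/
def rectDom : Set (Fin 2 → ℝ) := {t | 0 < t 1 ∧ 2 * t 1 < 1 ∧ 1 < 2 * t 0 ∧ t 0 < 1}

/-- The open square `(1,2)²`. -/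
def sqDom : Set (Fin 2 → ℝ) := {u | 1 < u 0 ∧ u 0 < 2 ∧ 1 < u 1 ∧ u 1 < 2}

/-- `D` is `ℚ`-semialgebraic. -/
theorem isSemialgebraic_dilogDom : IsSemialgebraic ℚ dilogDom := by
  have h : dilogDom = {t | 0 < aeval t (X 1 : MvPolynomial (Fin 2) ℚ)} ∩
      ({t | 0 < aeval t (X 0 - X 1 : MvPolynomial (Fin 2) ℚ)} ∩
        {t | 0 < aeval t (1 - 2 * X 0 : MvPolynomial (Fin 2) ℚ)}) := by
    ext t; simp [dilogDom, sub_pos]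
  rw [h]
  exact (isSemialgebraic_setOf_eval_pos _).inter
    ((isSemialgebraic_setOf_eval_pos _).inter (isSemialgebraic_setOf_eval_pos _))

/-- `U` is `ℚ`-semialgebraic. -/
theorem isSemialgebraic_upperDom : IsSemialgebraic ℚ upperDom := by
  have h : upperDom = {t | 0 < aeval t (2 * X 1 - 1 : MvPolynomial (Fin 2) ℚ)} ∩
      ({t | 0 < aeval t (X 0 - X 1 : MvPolynomial (Fin 2) ℚ)} ∩
        {t | 0 < aeval t (1 - X 0 : MvPolynomial (Fin 2) ℚ)}) := by
    ext t; simp [upperDom, sub_pos]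
  rw [h]
  exact (isSemialgebraic_setOf_eval_pos _).inter
    ((isSemialgebraic_setOf_eval_pos _).inter (isSemialgebraic_setOf_eval_pos _))

/-- `P` is `ℚ`-semialgebraic. -/
theorem isSemialgebraic_rectDom : IsSemialgebraic ℚ rectDom := by
  have h : rectDom = {t | 0 < aeval t (X 1 : MvPolynomial (Fin 2) ℚ)} ∩
      ({t | 0 < aeval t (1 - 2 * X 1 : MvPolynomial (Fin 2) ℚ)} ∩
        ({t | 0 < aeval t (2 * X 0 - 1 : MvPolynomial (Fin 2) ℚ)} ∩
          {t | 0 < aeval t (1 - X 0 : MvPolynomial (Fin 2) ℚ)})) := by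
    ext t; simp [rectDom, sub_pos]
  rw [h]
  exact (isSemialgebraic_setOf_eval_pos _).inter ((isSemialgebraic_setOf_eval_pos _).inter
    ((isSemialgebraic_setOf_eval_pos _).inter (isSemialgebraic_setOf_eval_pos _)))

/-- `(1,2)²` is `ℚ`-semialgebraic. -/
theorem isSemialgebraic_sqDom : IsSemialgebraic ℚ sqDom := by
  have h : sqDom = {t | 0 < aeval t (X 0 - 1 : MvPolynomial (Fin 2) ℚ)} ∩
      ({t | 0 < aeval t (2 - X 0 : MvPolynomial (Fin 2) ℚ)} ∩
        ({t | 0 < aeval t (X 1 - 1 : MvPolynomial (Fin 2) ℚ)} ∩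
          {t | 0 < aeval t (2 - X 1 : MvPolynomial (Fin 2) ℚ)})) := by
    ext t; simp [sqDom, sub_pos]
  rw [h]
  exact (isSemialgebraic_setOf_eval_pos _).inter ((isSemialgebraic_setOf_eval_pos _).inter
    ((isSemialgebraic_setOf_eval_pos _).inter (isSemialgebraic_setOf_eval_pos _)))

/-- `P` is measurable. -/
theorem measurableSet_rectDom : MeasurableSet rectDom :=
  IsSemialgebraic.measurableSet_holds isSemialgebraic_rectDom

/-- `D` is measurable. -/
theorem measurableSet_dilogDom : MeasurableSet dilogDom :=
  IsSemialgebraic.measurableSet_holds isSemialgebraic_dilogDom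

/-- `D ⊆ domain Λ₂`. -/
theorem dilogDom_subset : dilogDom ⊆ simplexTwo.domain := fun t ht =>
  mem_simplexTwo_domain.mpr ⟨ht.1, ht.2.1, by linarith [ht.2.2]⟩

/-- `U ⊆ domain Λ₂`. -/
theorem upperDom_subset : upperDom ⊆ simplexTwo.domain := fun t ht =>
  mem_simplexTwo_domain.mpr ⟨by linarith [ht.1], ht.2.1, ht.2.2⟩

/-- `P ⊆ domain Λ₂`. -/
theorem rectDom_subset : rectDom ⊆ simplexTwo.domain := fun t ht =>
  mem_simplexTwo_domain.mpr ⟨ht.1, by linarith [ht.2.1, ht.2.2.1], ht.2.2.2⟩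

/-- On the domain of `Λ₂`, its integrand is `dilogFun`. -/
theorem simplexTwo_integrand_eq (t : Fin 2 → ℝ) : simplexTwo.integrand t = dilogFun t := by
  rw [simplexTwo_integrand, dilogFun, one_div_mul_one_div]

/-- `dilogFun` is integrable on any subset of the domain of `Λ₂` that is measurable. -/
theorem integrableOn_dilogFun {S : Set (Fin 2 → ℝ)} (hS : S ⊆ simplexTwo.domain)
    (hm : MeasurableSet S) : IntegrableOn dilogFun S :=
  (simplexTwo.integrableOn.mono_set hS).congr_fun (fun t _ => simplexTwo_integrand_eq t) hm

/-- The denominator `t₀(1-t₁)` does not vanish on the domain of `Λ₂`. -/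
theorem dilogDen_ne_zero {t : Fin 2 → ℝ} (ht : t ∈ simplexTwo.domain) : t 0 * (1 - t 1) ≠ 0 := by
  obtain ⟨h1, h10, h0⟩ := mem_simplexTwo_domain.mp ht
  exact mul_ne_zero (by linarith) (by linarith)

/-- **`D = [½ > t₀ > t₁ > 0, dt₀dt₁/(t₀(1-t₁))]`, the representation of `Li₂(½)`.** -/
def dilogRep : IntegralRep 2 :=
  ratRep dilogDom dilogFun 1 (X 0 * (1 - X 1)) isSemialgebraic_dilogDom
    (fun t ht => by simpa using dilogDen_ne_zero (dilogDom_subset ht))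
    (fun t _ => by simp [dilogFun])
    (integrableOn_dilogFun dilogDom_subset measurableSet_dilogDom)

/-- `D` is `ℚ`-rational. -/
theorem isRational_dilogRep : dilogRep.IsRational := isRational_ratRep ..

/-- `[U, dt₀dt₁/(t₀(1-t₁))]`. -/
def upperDilogRep : IntegralRep 2 :=
  ratRep upperDom dilogFun 1 (X 0 * (1 - X 1)) isSemialgebraic_upperDom
    (fun t ht => by simpa using dilogDen_ne_zero (upperDom_subset ht))
    (fun t _ => by simp [dilogFun])
    (integrableOn_dilogFun upperDom_subset
      (IsSemialgebraic.measurableSet_holds isSemialgebraic_upperDom))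

/-- `[P, dt₀dt₁/(t₀(1-t₁))]`. -/
def rectRep : IntegralRep 2 :=
  ratRep rectDom dilogFun 1 (X 0 * (1 - X 1)) isSemialgebraic_rectDom
    (fun t ht => by simpa using dilogDen_ne_zero (rectDom_subset ht))
    (fun t _ => by simp [dilogFun])
    (integrableOn_dilogFun rectDom_subset measurableSet_rectDom)

/-! ## Move 1: the dissection `Λ₂ = D + U + P` -/

/-- **Move 1** (rule (3)): `[Λ₂] - [D] - [U] - [P] ∈ relations`. -/
theorem simplexTwo_dissect :
    of simplexTwo - of dilogRep - of upperDilogRep - of rectRep ∈ relations := by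
  have h := of_sub_sum_of_mem_relations (Finset.univ : Finset (Fin 3)) simplexTwo
    ![dilogRep, upperDilogRep, rectRep] (fun i _ => ?_) (fun i _ t ht => ?_) ?_ ?_
  · simpa [Fin.sum_univ_three, sub_sub] using h
  · fin_cases i
    · exact measure_mono_null (fun t ht => absurd (dilogDom_subset ht.1) ht.2) measure_empty
    · exact measure_mono_null (fun t ht => absurd (upperDom_subset ht.1) ht.2) measure_empty
    · exact measure_mono_null (fun t ht => absurd (rectDom_subset ht.1) ht.2) measure_empty
  · have e := simplexTwo_integrand_eq t
    fin_cases i <;> exact e.symm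
  · have hc : ∀ i : Fin 2, volume {t : Fin 2 → ℝ | t i = 1 / 2} = 0 := fun i => by
      rw [volume_pi]; exact Measure.pi_hyperplane (fun _ : Fin 2 => (volume : Measure ℝ)) i _
    refine measure_mono_null (fun t ht => ?_) (measure_union_null (hc 0) (hc 1))
    obtain ⟨hO, hn⟩ := ht
    obtain ⟨h1, h10, h0⟩ := mem_simplexTwo_domain.mp hO
    simp only [Finset.mem_univ, iUnion_true, mem_iUnion, not_exists] at hn
    have hD : t ∉ dilogDom := hn 0
    have hU : t ∉ upperDom := hn 1
    have hP : t ∉ rectDom := hn 2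
    simp only [dilogDom, upperDom, rectDom, mem_setOf_eq, not_and, not_lt] at hD hU hP
    by_contra hc
    simp only [mem_union, mem_setOf_eq, not_or] at hc
    rcases lt_or_gt_of_ne hc.1 with ha | ha
    · exact absurd (hD h1 h10) (by linarith)
    · rcases lt_or_gt_of_ne hc.2 with hb | hb
      · exact absurd (hP h1 (by linarith) (by linarith)) (by linarith)
      · exact absurd (hU (by linarith) h10) (by linarith)
  · intro i _ j _ hij
    have hDU : dilogDom ∩ upperDom = ∅ := eq_empty_of_forall_notMem fun t ⟨hD, hU⟩ => by
      have := hD.2.2; have := hU.1; have := hU.2.1; linarith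
    have hDP : dilogDom ∩ rectDom = ∅ := eq_empty_of_forall_notMem fun t ⟨hD, hP⟩ => by
      have := hD.2.2; have := hP.2.2.1; linarith
    have hUP : upperDom ∩ rectDom = ∅ := eq_empty_of_forall_notMem fun t ⟨hU, hP⟩ => by
      have := hU.1; have := hP.2.1; linarith
    fin_cases i <;> fin_cases j
    · exact absurd rfl hij
    · show volume (dilogDom ∩ upperDom) = 0
      rw [hDU, measure_empty]
    · show volume (dilogDom ∩ rectDom) = 0
      rw [hDP, measure_empty]
    · show volume (upperDom ∩ dilogDom) = 0
      rw [inter_comm, hDU, measure_empty]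
    · exact absurd rfl hij
    · show volume (upperDom ∩ rectDom) = 0
      rw [hUP, measure_empty]
    · show volume (rectDom ∩ dilogDom) = 0
      rw [inter_comm, hDP, measure_empty]
    · show volume (rectDom ∩ upperDom) = 0
      rw [inter_comm, hUP, measure_empty]
    · exact absurd rfl hij

/-! ## Move 2: the reflection `(t₀,t₁) ↦ (1-t₁, 1-t₀)` -/

/-- The reflection `ρ(t) = (1-t₁, 1-t₀)`. -/
def reflChart (t : Fin 2 → ℝ) : Fin 2 → ℝ := ![1 - t 1, 1 - t 0]

/-- `Dρ` (constant). -/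
def reflDeriv : (Fin 2 → ℝ) →L[ℝ] (Fin 2 → ℝ) := ContinuousLinearMap.pi ![-pr2 1, -pr2 0]

/-- `ρ` is differentiable with derivative `reflDeriv`. -/
theorem hasFDerivAt_reflChart (t : Fin 2 → ℝ) : HasFDerivAt reflChart reflDeriv t := by
  rw [hasFDerivAt_pi']
  intro i
  have hrow : (pr2 i).comp reflDeriv = ![-pr2 1, -pr2 0] i :=
    ContinuousLinearMap.ext fun v => by simp [reflDeriv]
  rw [hrow]
  fin_cases i
  · simpa [reflChart] using (hasFDerivAt_apply (1 : Fin 2) t).const_sub 1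
  · simpa [reflChart] using (hasFDerivAt_apply (0 : Fin 2) t).const_sub 1

/-- The matrix of `Dρ`. -/
theorem toMatrix_reflDeriv :
    LinearMap.toMatrix' ((reflDeriv : (Fin 2 → ℝ) →L[ℝ] (Fin 2 → ℝ)) :
      (Fin 2 → ℝ) →ₗ[ℝ] (Fin 2 → ℝ)) = !![0, -1; -1, 0] := by
  ext i j
  rw [LinearMap.toMatrix'_apply, ContinuousLinearMap.coe_coe]
  fin_cases i <;> fin_cases j <;> simp [reflDeriv]

/-- `|det Dρ| = 1`. -/
theorem abs_det_reflDeriv : |reflDeriv.det| = 1 := by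
  rw [ContinuousLinearMap.det, ← LinearMap.det_toMatrix', toMatrix_reflDeriv, Matrix.det_fin_two]
  simp

/-- `ρ` is injective. -/
theorem injective_reflChart : Function.Injective reflChart := by
  intro s t h
  have h0 := congrFun h 0
  have h1 := congrFun h 1
  simp only [reflChart, Matrix.cons_val_zero, Matrix.cons_val_one] at h0 h1
  funext i
  fin_cases i
  · show s 0 = t 0
    linarith
  · show s 1 = t 1
    linarith

/-- `ρ(D) = U`. -/
theorem image_reflChart : reflChart '' dilogDom = upperDom := by
  ext u
  constructor
  · rintro ⟨t, ⟨h1, h10, h0⟩, rfl⟩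
    refine ⟨?_, ?_, ?_⟩ <;>
      simp only [reflChart, Matrix.cons_val_zero, Matrix.cons_val_one] <;> linarith
  · rintro ⟨h1, h10, h0⟩
    refine ⟨![1 - u 1, 1 - u 0], ⟨?_, ?_, ?_⟩, ?_⟩
    · show 0 < 1 - u 0
      linarith
    · show 1 - u 0 < 1 - u 1
      linarith
    · show 2 * (1 - u 1) < 1
      linarith
    · funext i
      fin_cases i
      · show 1 - (1 - u 0) = u 0
        ring
      · show 1 - (1 - u 1) = u 1
        ring

/-- `ρ` is a `ℚ`-polynomial map. -/
theorem isSemialgebraicMapOn_reflChart : IsSemialgebraicMapOn ℚ dilogDom reflChart := by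
  refine IsSemialgebraicMapOn.of_forall isSemialgebraic_dilogDom fun i => ?_
  fin_cases i
  · exact (isSemialgebraicFunOn_aeval isSemialgebraic_dilogDom (1 - X 1)).congr
      fun t _ => by simp [reflChart]
  · exact (isSemialgebraicFunOn_aeval isSemialgebraic_dilogDom (1 - X 0)).congr
      fun t _ => by simp [reflChart]

/-- **Move 2** (rule (2)): `[D] ≡ [U]` — the form `dt₀dt₁/(t₀(1-t₁))` is `ρ`-invariant. -/
theorem dilogRep_equiv_upper : Equivalent dilogRep upperDilogRep :=
  equivalent_of_chart isSemialgebraicMapOn_reflChart (fun t _ => hasFDerivAt_reflChart t)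
    injective_reflChart.injOn image_reflChart (fun _ _ => abs_det_reflDeriv)
    (f := dilogFun) (g := dilogFun)
    (fun t _ => by
      simp only [dilogFun, reflChart, Matrix.cons_val_zero, Matrix.cons_val_one]
      ring)
    rfl (fun _ _ => rfl) rfl fun _ _ => rfl

end SoloBlind

end Summit.KontsevichZagierPeriods.KontsevichZagierPeriods.Theorems
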